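import Literature.Computability.Learning.FpGLStageFP
import Literature.Computability.Learning.ModpPredictorFP
import HarnessLib

/-!
# The hypothesis evaluator of the `AC⁰[p]` learner in `FP`

Machine-layer groundwork for the named fact `Literature.Computability.Learning.cikk_learn_AC0Mod`
(CIKK 2016, Cor. 5.4): the evaluator `E(h, x)` of the unified learner's hypotheses, the analogue
of `EvalFP.lean`. A hypothesis string is `⟨D, qbits₀⟩`: the DP record (`DPDecodeFP.dpRec`, points
of `UJ = {0,1}ⁿ × Fin B` as `(n+β)`-bit strings) over the GL record over the vN record over the
predictor record of one run, and the junk coin `q₀`. The evaluator appends the junk bits to the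
challenge point and runs `decodeFn (candVecPFn (vnPredFn (ColDesign.predFn Modp.colValFn dR)))`:

* `decode_comp` — the IJKW decoder is natural in the point type (no injectivity needed);
* `evalPFn dR` (`∈ FP` for `dR ∈ FP`, one-bit), the record `hypRecP` of one run, and
  **`evalPFn_apply`**: on a genuine record the value is `[runHypP (designP …) (natTest R ℓ) f θ ω x]`.

## References

* M. Carmosino, R. Impagliazzo, V. Kabanets, A. Kolokolova, *Learning algorithms from natural
  proofs*, CCC 2016, §5 (complete algorithm) with Thm. 4.8 [CarmosinoImpagliazzoKabanetsKolokolova2016].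
-/

open Polynomial

namespace Literature.Computability.Learning

open Literature.Computability.Complexity Literature.Computability.Complexity.Brick
  Literature.Computability.Complexity.Plumb Literature.Computability.Complexity.DirectProduct
  Literature.Computability.MetaComplexity Literature.Computability.MetaComplexity.GFDesign
  Literature.Computability.Cryptography Literature.Computability.Complexity.GaussRank _root_.Computability Finset Function

/-! ### Naturality of the decoder in the point type -/

section Naturality

variable {U V R : Type*} {k : ℕ} [DecidableEq R]

omit [DecidableEq R] in
/-- `fill` commutes with a map of points. [folklore] -/
theorem fill_comp (ι : U → V) (P : Finset (Fin k)) (a y : Fin k → U) : fill P (ι ∘ a) (ι ∘ y) = ι ∘ fill P a y := by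
  funext i; simp only [fill, Function.comp_apply]; split_ifs <;> rfl

omit [DecidableEq R] in
/-- `update` commutes with a map of points. [folklore] -/
theorem update_comp' (ι : U → V) (y : Fin k → U) (j : Fin k) (x : U) : update (ι ∘ y) j (ι x) = ι ∘ update y j x := by
  funext i; by_cases h : i = j
  · subst h; simp
  · simp [update_of_ne h]

/-- **The IJKW decoder is natural in the point type.** [cite: ImpagliazzoEtAl2010, Algorithm 1] -/
theorem decode_comp (ι : U → V) (C : (Fin k → V) → Fin k → R) (P : Finset (Fin k)) (a : Fin k → U) (v : Fin k → R) (d₀ : R)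
    {t : ℕ} (steps : Fin t → Fin k × (Fin k → U)) (x : U) :
    decode C P (ι ∘ a) v d₀ (fun r => ((steps r).1, ι ∘ (steps r).2)) (ι x) = decode (fun xs => C (ι ∘ xs)) P a v d₀ steps x := by
  unfold decode
  rw [show (List.ofFn fun r => ((steps r).1, ι ∘ (steps r).2)) = (List.ofFn steps).map fun σ => (σ.1, ι ∘ σ.2) by
    rw [List.map_ofFn]; rfl]
  generalize List.ofFn steps = l
  induction l with
  | nil => rfl
  | cons σ l ih =>
      have hst : stepTuple P (ι ∘ a) (ι x) (σ.1, ι ∘ σ.2) = ι ∘ stepTuple P a x σ := by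
        unfold stepTuple; rw [update_comp', fill_comp]
      have hans : Answers C P (ι ∘ a) v (ι x) (σ.1, ι ∘ σ.2) ↔ Answers (fun xs => C (ι ∘ xs)) P a v x σ := by
        unfold Answers; rw [hst]
      rw [List.map_cons, decodeList, decodeList, ih]
      by_cases h : Answers (fun xs => C (ι ∘ xs)) P a v x σ
      · rw [if_pos (hans.2 h), if_pos h, hst]
      · rw [if_neg (fun h' => h (hans.1 h')), if_neg h]

end Naturality

/-! ### The evaluator -/

open Modp

variable [P : PrimeP]

/-- The argument reshaping `⟨⟨D, qbits₀⟩, xbits⟩ ↦ ⟨D, xbits ++ qbits₀⟩`. [folklore] -/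
noncomputable def evalArgF : List Bool → List Bool := fanoutFn (fstF ∘ fstF) (fun z => sndF z ++ (sndF ∘ fstF) z)

omit P in
/-- `evalArgF ∈ FP`. [folklore] -/
theorem evalArgF_mem_FP : evalArgF ∈ FP :=
  fanoutFn_mem_FP (comp_mem_FP fstF_mem_FP fstF_mem_FP) (append_mem_FP sndF_mem_FP (comp_mem_FP sndF_mem_FP fstF_mem_FP))

omit P in
/-- Value of `evalArgF`. [folklore] -/
theorem evalArgF_apply (D q x : List Bool) : evalArgF (boolPair (boolPair D q) x) = boolPair D (x ++ q) := by
  simp [evalArgF, fanoutFn_apply]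

/-- **The evaluator** `E`: append the junk bits to the point, then DP decoder ∘ `𝔽_p`-GL stage ∘
vN stage ∘ table-based NW predictor, with the decision procedure `dR` of the property.
[cite: CarmosinoImpagliazzoKabanetsKolokolova2016, §5 (steps 3–5) with Thm. 4.8] -/
noncomputable def evalPFn (dR : List Bool → List Bool) : List Bool → List Bool :=
  decodeFn (candVecPFn 𝔭 (ColDesign.predFn Modp.colValFn dR)) ∘ evalArgF

/-- **`evalPFn dR ∈ FP`** for `dR ∈ FP`. [cite: CarmosinoImpagliazzoKabanetsKolokolova2016, Thm. 5.1 (running time)] -/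
theorem evalPFn_mem_FP {dR : List Bool → List Bool} (hdR : dR ∈ FP) : evalPFn dR ∈ FP := by
  unfold evalPFn
  exact comp_mem_FP (decodeFn_mem_FP (candVecPFn_mem_FP (ColDesign.predFn_mem_FP Modp.colValFn Modp.colValFn_mem_FP hdR))) evalArgF_mem_FP

/-- `evalPFn dR` is one-bit. [folklore] -/
theorem oneBit_evalPFn (dR : List Bool → List Bool) : OneBit (evalPFn dR) := by
  unfold evalPFn; exact (oneBit_decodeFn _).comp _

/-! ### The record of one run and the value of the evaluator -/

/-- The header of the amplifier parameters `⟨1ⁿ, ⟨1ᵏ, ⟨1^β, 1ᵀ⟩⟩⟩` (the `pad` of the predictor record).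
[folklore] -/
def ampHdr (n k β T : ℕ) : List Bool := boolPair (ones n) (boolPair (ones k) (boolPair (ones β) (ones T)))

/-- The bits of the junk coin. [folklore] -/
def junkBits {β : ℕ} {p : ℕ} (q : Fin (jB p β)) : List Bool := List.ofFn fun e : Fin β => (q : ℕ).testBit e

variable {n k β T ℓ te kk t : ℕ}

/-- **The hypothesis record of one run** with coins `ω`: the DP record (points of `UJ` as strings)
over the GL record over the vN record (real labels `G(w_c)` precomputed) over the predictor record
(tables `tbls`), and the junk bits. [cite: CarmosinoImpagliazzoKabanetsKolokolova2016, §5] -/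
def hypRecP (te ℓ : ℕ) (tbls : List (List Bool)) (f : (Fin n → Bool) → Bool) (θN θD : ℕ)
    (ω : RunCoinsP n 𝔭 β k T (2 ^ ℓ) (𝔭 ^ te * 𝔭 ^ te) kk t) : List Bool :=
  let P := predRec (predHdr (ampHdr n k β T) (𝔭 ^ te) ℓ (T * 2 * (k * n + k * β)) (2 ^ ℓ))
    (List.ofFn ((boolFunEquivFin ℓ).symm ω.1.1.1.1.1)) (List.ofFn ω.1.1.1.1.2.2) (OracleCompose.body tbls) (List.ofFn ω.1.1.1.1.2.1)
  let V := vnRecOf P (dpGLP (fJ (p := 𝔭) (β := β) f)) ω.1.1.1.2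
  let Gr := glRecOf V n k β kk ω.1.1.2.1 ω.1.1.2.2 θN θD
  boolPair (dpRec (glRecE 𝔭 Gr) (n + β) k t (List.ofFn ω.1.2.1) (tupleBits (encRow ∘ ω.1.2.2.1)) (List.ofFn (fJ f ∘ ω.1.2.2.1))
    (stepsCode fun r => ((ω.1.2.2.2 r).1, encRow ∘ (ω.1.2.2.2 r).2))) (junkBits ω.2)

omit P in
/-- The string of a point and the junk bits is the encoded row. [folklore] -/
theorem ofFn_append_junkBits {p : ℕ} (x : Fin n → Bool) (q : Fin (jB p β)) :
    List.ofFn x ++ junkBits q = List.ofFn (encRow (x, q)) := by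
  rw [encRow, List.ofFn_fin_append]; rfl

/-- **The evaluator computes the run's hypothesis.** If the stored tables are the tables of
`AMP_p(f)` for the challenge block `i` and the seed `z`, then
`evalPFn dR ⟨hypRecP …, x⟩ = [runHypP (designP …) (natTest R ℓ) f (θN/θD) ω x]`.
[cite: CarmosinoImpagliazzoKabanetsKolokolova2016, §5 (complete algorithm) with Thm. 4.8] -/
theorem evalPFn_apply (hte : te ≠ 0) (hn : T * 2 * (k * n + k * β) ≤ 𝔭 ^ te) (hβ : 𝔭 ≤ 2 ^ β) (R : CombinatorialProperty)
    {dR : List Bool → List Bool} (hdRFP : dR ∈ FP) (hdR : ∀ y, dR y = encodeBool ((truthTableLanguage R).boolIndicator y))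
    (tbls : List (List Bool)) (f : (Fin n → Bool) → Bool) {θN θD : ℕ} (hθD : 0 < θD)
    (ω : RunCoinsP n 𝔭 β k T (2 ^ ℓ) (𝔭 ^ te * 𝔭 ^ te) kk t)
    (htbls : ∀ j : Fin (2 ^ ℓ), (j : ℕ) < ω.1.1.1.1.1 →
      tbls.getD j [] = ColDesign.tableList (Modp.colVal (𝔭 ^ te) ℓ) (Modp.designP hte _ ℓ hn) (ampPFin 𝔭 f k β T) ω.1.1.1.1.1 j ω.1.1.1.1.2.1)
    (x : Fin n → Bool) :
    evalPFn dR (boolPair (hypRecP te ℓ tbls f θN θD ω) (List.ofFn x)) =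
      [runHypP (Modp.designP hte _ ℓ hn) (natTest R ℓ) f ((θN : ℝ) / θD) ω x] := by
  obtain ⟨⟨⟨⟨adv, c⟩, sg⟩, dc⟩, q₀⟩ := ω
  obtain ⟨i, z, w⟩ := adv
  obtain ⟨Pb, a, steps⟩ := dc
  -- reshape the argument
  rw [evalPFn, comp_apply]
  simp only [hypRecP, evalArgF_apply]
  set Pr := predRec (predHdr (ampHdr n k β T) (𝔭 ^ te) ℓ (T * 2 * (k * n + k * β)) (2 ^ ℓ))
    (List.ofFn ((boolFunEquivFin ℓ).symm i)) (List.ofFn w) (OracleCompose.body tbls) (List.ofFn z) with hPr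
  set H := ColDesign.predFn Modp.colValFn dR with hH
  set h₁ := nwStageP 𝔭 (Modp.designP hte _ ℓ hn) (natTest R ℓ) f (i, z, w) with hh₁
  have hHFP : H ∈ FP := ColDesign.predFn_mem_FP _ Modp.colValFn_mem_FP hdRFP
  have hHP : ∀ x' : Fin (T * 2 * (k * n + k * β)) → Bool, H (boolPair Pr (List.ofFn x')) = [h₁ x'] := fun x' =>
    Modp.predFn_eq_nwPredictor hte hn R hdR (ampHdr n k β T) (ampPFin 𝔭 f k β T) i z w x' tbls htbls
  have hG := fun v : Fin k → (Fin (n + β) → Bool) => candVecPFn_apply_genuine hβ hHFP Pr h₁ hHP f c sg.1 sg.2 (θN := θN) hθD v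
  -- decode
  set C'' : (Fin k → (Fin (n + β) → Bool)) → Fin k → Bool :=
    fun xs => glStageP (vnStageP f h₁ c) ((θN : ℝ) / θD) (sg.1, sg.2) fun i' => decodeRow (jB_pos hβ) (xs i') with hC''
  rw [ofFn_append_junkBits, decodeFn_apply C'' hG Pb (encRow ∘ a) (fJ f ∘ a) (fun r => ((steps r).1, encRow ∘ (steps r).2)) (encRow (x, q₀))]
  have hnat := decode_comp (encRow (n := n) (p := 𝔭) (β := β)) C'' (posSet Pb) a (fJ f ∘ a) false steps (x, q₀)
  have hC : (fun xs : Fin k → UJ n 𝔭 β => C'' (encRow ∘ xs)) = glStageP (vnStageP f h₁ c) ((θN : ℝ) / θD) sg := by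
    funext xs
    simp only [hC'', Function.comp_apply, decodeRow_encRow]
  rw [hnat, hC]
  rfl

end Literature.Computability.Learning
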